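import Summits.HodgeConjecture.CorCM.GaloisDihedralMirrorTypes
import HarnessLib

/-!
# Mirror CM types for the Galois groups `D_m × C₂` (`DihedralGroup m × Multiplicative (ZMod 2)`): the generalised
# dihedral group of `A = ℤ/m × ℤ/2`

COR-CM (cell `pub-hodgecm2`), binder seat b04 (gen 22), count-neutral claim GALOIS-DIHEDRAL, part V — the mechanism of
part I (`CorCM/GaloisDihedralMirrorTypes`) for the product `G₀ = DihedralGroup m × Multiplicative (ZMod 2)`.  KERNEL ONLY:
theorems; no definition, no named fact, no `sorry`.  `HC_CM` is neither used nor claimed.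

`G₀` is the generalised dihedral group `Dih(A)` of the abelian group `A = ℤ/m × ℤ/2`: with the two sheets
`ρ(p) = (r p₁, p₂)` and `σ(p) = (sr p₁, p₂)` (`p = (p₁, p₂) ∈ A`, second coordinate written multiplicatively) the
multiplication table is that of part I VERBATIM — `ρ(p)ρ(q) = ρ(p+q)`, `ρ(p)σ(q) = σ(q−p)`, `σ(p)ρ(q) = σ(p+q)`,
`σ(p)σ(q) = ρ(q−p)` (§2; `−z = z` in `ℤ/2`).  Hence for a CM HALF `S₁ ⊆ A` for `h ∈ A` (`p ∈ S₁ ⟺ h + p ∉ S₁`; complex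
conjugation `c₀ = ρ(h)`, e.g. `h = (n, 0)` for `m = 2n`: `c₀ = (rⁿ, 1)`) and `t ∈ A`, the MIRROR TYPE
`T = ρ(S₁) ⊔ {σ(p) : t − p ∈ S₁}` is a CM set, BALANCED against `D = ρ(S₁) ⊔ {σ(p) : t − p ∉ S₁}` by the symmetry of the
autocorrelation of `S₁` (§1, now over any finite abelian group), moved by `c₀`, and has trivial left stabiliser iff `S₁`
is aperiodic and asymmetric in `A` (§3).  §4 **`exists_simple_degenerate_of_mirror₂`**: a Galois CM field `K` with
`e : Gal(K/ℚ) ≃* DihedralGroup m × Multiplicative (ZMod 2)`, `e(c) = ρ(h)`, and an aperiodic asymmetric CM half of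
`ℤ/m × ℤ/2` for `h` has a SIMPLE DEGENERATE abelian variety of dimension `2m` with CM by `K` (certificate format of gen
19/20, `GaloisModels.exists_simple_degenerate_of_model_balanced`).  Part VI supplies the halves (`m = 2n`, `n ≥ 4`) and the
classification of the family `D_{2n} × C₂`, `c = (rⁿ, 1)`: good ⟺ `n ≤ 2`.

## References

* [Shimura1998] G. Shimura, *Abelian Varieties with Complex Multiplication and Modular Functions*, §6.2 Thm. 3,
  §8.2 Prop. 26, §18.2 Lemma (i).
* [Gordon1999HodgeAVSurvey] B. B. Gordon, *A survey of the Hodge conjecture for abelian varieties*, Thm. 6.4, §9.3.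
* [Kubota1965] T. Kubota, Trans. AMS 118 (1965), §2.
-/

noncomputable section

open CategoryTheory CategoryTheory.Limits NumberField
open scoped BigOperators

namespace Summit.HodgeConjecture.CorCM.GaloisDihedralTimesTwo

open Literature.NumberTheory.ComplexMultiplication
open Literature.AlgebraicGeometry.Motives (AbelianVariety CMType)
open Literature.AlgebraicGeometry.HodgeTheory
open Literature.AlgebraicGeometry.ComplexMultiplication (IsCMTypeRealisation)
open Literature.AlgebraicGeometry.Pohlmann1968
open Literature.Barriers.HodgeConjecture (divisorClassesSpan)
open Summit.HodgeConjecture.CorCM.GaloisModels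
open DihedralGroup

/-! ## §1 Counting on a finite abelian group: shifts, reflections, the autocorrelation -/

section Counting

variable {A : Type*} [AddCommGroup A] [Fintype A] [DecidableEq A]

omit [DecidableEq A] in
/-- Counting through a translation: `#{k : R (k + j)} = #{u : R u}`. [folklore] -/
theorem card_filter_add_right (R : A → Prop) [DecidablePred R] (j : A) :
    (Finset.univ.filter fun k => R (k + j)).card = (Finset.univ.filter R).card := by
  simp only [Finset.card_filter]
  exact Fintype.sum_equiv (Equiv.addRight j) _ _ fun _ => rfl

omit [DecidableEq A] in
/-- Counting through a reflection: `#{k : R (t - k)} = #{u : R u}`. [folklore] -/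
theorem card_filter_sub_left (R : A → Prop) [DecidablePred R] (t : A) :
    (Finset.univ.filter fun k => R (t - k)).card = (Finset.univ.filter R).card := by
  simp only [Finset.card_filter]
  exact Fintype.sum_equiv (Equiv.subLeft t) _ _ fun _ => rfl

/-- **Symmetry of the autocorrelation**: `#{k ∈ S₁ : k + j ∈ S₁} = #{k ∈ S₁ : k - j ∈ S₁}`. [folklore] -/
theorem card_autocorrelation_symm (S₁ : Finset A) (j : A) :
    (Finset.univ.filter fun k => k ∈ S₁ ∧ k + j ∈ S₁).card =
      (Finset.univ.filter fun k => k ∈ S₁ ∧ k - j ∈ S₁).card := by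
  rw [← card_filter_add_right (fun k => k ∈ S₁ ∧ k - j ∈ S₁) j]
  congr 1
  refine Finset.filter_congr fun k _ => ?_
  rw [add_sub_cancel_right, and_comm]

/-- `#{u ∉ S₁ : u + j ∈ S₁} + #{u ∈ S₁ : u + j ∈ S₁} = #S₁`. [folklore] -/
theorem card_filter_not_mem_add (S₁ : Finset A) (j : A) :
    (Finset.univ.filter fun u => u ∉ S₁ ∧ u + j ∈ S₁).card +
      (Finset.univ.filter fun u => u ∈ S₁ ∧ u + j ∈ S₁).card = S₁.card := by
  have hs : (Finset.univ.filter fun u : A => u + j ∈ S₁).card = S₁.card := by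
    rw [card_filter_add_right (fun u => u ∈ S₁) j, Finset.filter_univ_mem]
  rw [← hs, ← Finset.card_filter_add_card_filter_not
    (s := Finset.univ.filter fun u : A => u + j ∈ S₁) (fun u => u ∉ S₁), Finset.filter_filter,
    Finset.filter_filter]
  congr 2
  · exact Finset.filter_congr fun u _ => and_comm
  · exact Finset.filter_congr fun u _ => by rw [not_not, and_comm]

/-- **A CM half has `|A|/2` elements**: `k ∈ S₁ ⟺ h + k ∉ S₁` forces `2 · #S₁ = |A|`. [folklore] -/
theorem two_mul_card_of_half (S₁ : Finset A) (h : A) (hS : ∀ k, k ∈ S₁ ↔ h + k ∉ S₁) :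
    2 * S₁.card = Fintype.card A := by
  classical
  have himage : S₁ᶜ = S₁.image fun k => h + k := by
    ext u
    simp only [Finset.mem_compl, Finset.mem_image]
    constructor
    · intro hu
      refine ⟨u - h, ?_, by abel⟩
      rw [hS, add_sub_cancel]
      exact hu
    · rintro ⟨k, hk, rfl⟩
      exact (hS k).1 hk
  have h1 : S₁ᶜ.card = S₁.card := by
    rw [himage, Finset.card_image_of_injective _ (add_right_injective h)]
  have h2 := Finset.card_compl S₁
  have h3 : S₁.card ≤ Fintype.card A := Finset.card_le_univ S₁
  omega

end Counting

/-! ## §2 The two sheets of `DihedralGroup m × Multiplicative (ZMod 2)` over `A = ℤ/m × ℤ/2` -/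

section Sheets

variable {m : ℕ}

/-- `ρ(p) ρ(q) = ρ(p + q)`. [folklore] -/
theorem rot_mul_rot (p q : ZMod m × ZMod 2) :
    ((r p.1, Multiplicative.ofAdd p.2) : DihedralGroup m × Multiplicative (ZMod 2)) *
      (r q.1, Multiplicative.ofAdd q.2) = (r (p + q).1, Multiplicative.ofAdd (p + q).2) := by
  rw [Prod.mk_mul_mk, r_mul_r, Prod.fst_add, Prod.snd_add, ofAdd_add]

/-- `ρ(p) σ(q) = σ(q - p)` (`-z = z` in `ℤ/2`). [folklore] -/
theorem rot_mul_refl (p q : ZMod m × ZMod 2) :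
    ((r p.1, Multiplicative.ofAdd p.2) : DihedralGroup m × Multiplicative (ZMod 2)) *
      (sr q.1, Multiplicative.ofAdd q.2) = (sr (q - p).1, Multiplicative.ofAdd (q - p).2) := by
  rw [Prod.mk_mul_mk, r_mul_sr, Prod.fst_sub, Prod.snd_sub, ← ofAdd_add, sub_eq_add_neg q.2,
    ZMod.neg_eq_self_mod_two, add_comm q.2]

/-- `σ(p) ρ(q) = σ(p + q)`. [folklore] -/
theorem refl_mul_rot (p q : ZMod m × ZMod 2) :
    ((sr p.1, Multiplicative.ofAdd p.2) : DihedralGroup m × Multiplicative (ZMod 2)) *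
      (r q.1, Multiplicative.ofAdd q.2) = (sr (p + q).1, Multiplicative.ofAdd (p + q).2) := by
  rw [Prod.mk_mul_mk, sr_mul_r, Prod.fst_add, Prod.snd_add, ofAdd_add]

/-- `σ(p) σ(q) = ρ(q - p)`. [folklore] -/
theorem refl_mul_refl (p q : ZMod m × ZMod 2) :
    ((sr p.1, Multiplicative.ofAdd p.2) : DihedralGroup m × Multiplicative (ZMod 2)) *
      (sr q.1, Multiplicative.ofAdd q.2) = (r (q - p).1, Multiplicative.ofAdd (q - p).2) := by
  rw [Prod.mk_mul_mk, sr_mul_sr, Prod.fst_sub, Prod.snd_sub, ← ofAdd_add, sub_eq_add_neg q.2,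
    ZMod.neg_eq_self_mod_two, add_comm q.2]

/-- Every element lies on one of the two sheets. [folklore] -/
theorem exists_sheet (g : DihedralGroup m × Multiplicative (ZMod 2)) :
    ∃ p : ZMod m × ZMod 2, g = (r p.1, Multiplicative.ofAdd p.2) ∨ g = (sr p.1, Multiplicative.ofAdd p.2) := by
  obtain ⟨d, w⟩ := g
  rcases d with k | k
  · exact ⟨(k, Multiplicative.toAdd w), Or.inl rfl⟩
  · exact ⟨(k, Multiplicative.toAdd w), Or.inr rfl⟩

/-- Counting sheet by sheet: `#{g : Q g} = #{p : Q (ρ p)} + #{p : Q (σ p)}`. [folklore] -/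
theorem card_filter_sheets [NeZero m] (Q : DihedralGroup m × Multiplicative (ZMod 2) → Prop) [DecidablePred Q] :
    (Finset.univ.filter Q).card =
      (Finset.univ.filter fun p : ZMod m × ZMod 2 => Q (r p.1, Multiplicative.ofAdd p.2)).card +
        (Finset.univ.filter fun p : ZMod m × ZMod 2 => Q (sr p.1, Multiplicative.ofAdd p.2)).card := by
  have split : ∀ F : DihedralGroup m → ℕ, ∑ d, F d = ∑ k, F (r k) + ∑ k, F (sr k) := fun F => by
    rw [Fintype.sum_equiv equivSum F (fun y => F (equivSum.symm y)) fun x => by rw [Equiv.symm_apply_apply],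
      Fintype.sum_sum_type]
    rfl
  simp only [Finset.card_filter]
  rw [Fintype.sum_prod_type, Fintype.sum_prod_type, Fintype.sum_prod_type, split]
  rfl

end Sheets

/-! ## §3 The mirror type: existence, CM property, the balanced set, the left stabiliser -/

section Mirror

variable {m : ℕ} {S₁ : Finset (ZMod m × ZMod 2)} {t h : ZMod m × ZMod 2}
variable {T D : Finset (DihedralGroup m × Multiplicative (ZMod 2))}

/-- **The mirror type exists**: `ρ p ∈ T ↔ p ∈ S₁`, `σ p ∈ T ↔ t - p ∈ S₁`. [folklore] -/
theorem exists_mirror [NeZero m] (S₁ : Finset (ZMod m × ZMod 2)) (t : ZMod m × ZMod 2) :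
    ∃ T : Finset (DihedralGroup m × Multiplicative (ZMod 2)),
      (∀ p, (r p.1, Multiplicative.ofAdd p.2) ∈ T ↔ p ∈ S₁) ∧
      (∀ p, (sr p.1, Multiplicative.ofAdd p.2) ∈ T ↔ t - p ∈ S₁) := by
  classical
  refine ⟨Finset.univ.filter fun g => ∃ p, (g = (r p.1, Multiplicative.ofAdd p.2) ∧ p ∈ S₁) ∨
      (g = (sr p.1, Multiplicative.ofAdd p.2) ∧ t - p ∈ S₁), fun p => ?_, fun p => ?_⟩
  · simp only [Finset.mem_filter, Finset.mem_univ, true_and]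
    constructor
    · rintro ⟨q, (⟨hq, hq'⟩ | ⟨hq, -⟩)⟩
      · obtain ⟨q1, q2⟩ := q
        simp only [Prod.mk.injEq, r.injEq] at hq
        obtain ⟨rfl, h2⟩ := hq
        have : p.2 = q2 := Multiplicative.ofAdd.injective h2
        subst this
        exact hq'
      · simp at hq
    · exact fun hp => ⟨p, Or.inl ⟨rfl, hp⟩⟩
  · simp only [Finset.mem_filter, Finset.mem_univ, true_and]
    constructor
    · rintro ⟨q, (⟨hq, -⟩ | ⟨hq, hq'⟩)⟩
      · simp at hq
      · obtain ⟨q1, q2⟩ := q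
        simp only [Prod.mk.injEq, sr.injEq] at hq
        obtain ⟨rfl, h2⟩ := hq
        have : p.2 = q2 := Multiplicative.ofAdd.injective h2
        subst this
        exact hq'
    · exact fun hp => ⟨p, Or.inr ⟨rfl, hp⟩⟩

/-- **The companion set exists**: `ρ p ∈ D ↔ p ∈ S₁`, `σ p ∈ D ↔ t - p ∉ S₁`. [folklore] -/
theorem exists_comirror [NeZero m] (S₁ : Finset (ZMod m × ZMod 2)) (t : ZMod m × ZMod 2) :
    ∃ D : Finset (DihedralGroup m × Multiplicative (ZMod 2)),
      (∀ p, (r p.1, Multiplicative.ofAdd p.2) ∈ D ↔ p ∈ S₁) ∧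
      (∀ p, (sr p.1, Multiplicative.ofAdd p.2) ∈ D ↔ t - p ∉ S₁) := by
  classical
  refine ⟨Finset.univ.filter fun g => ∃ p, (g = (r p.1, Multiplicative.ofAdd p.2) ∧ p ∈ S₁) ∨
      (g = (sr p.1, Multiplicative.ofAdd p.2) ∧ t - p ∉ S₁), fun p => ?_, fun p => ?_⟩
  · simp only [Finset.mem_filter, Finset.mem_univ, true_and]
    constructor
    · rintro ⟨q, (⟨hq, hq'⟩ | ⟨hq, -⟩)⟩
      · obtain ⟨q1, q2⟩ := q
        simp only [Prod.mk.injEq, r.injEq] at hq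
        obtain ⟨rfl, h2⟩ := hq
        have : p.2 = q2 := Multiplicative.ofAdd.injective h2
        subst this
        exact hq'
      · simp at hq
    · exact fun hp => ⟨p, Or.inl ⟨rfl, hp⟩⟩
  · simp only [Finset.mem_filter, Finset.mem_univ, true_and]
    constructor
    · rintro ⟨q, (⟨hq, -⟩ | ⟨hq, hq'⟩)⟩
      · simp at hq
      · obtain ⟨q1, q2⟩ := q
        simp only [Prod.mk.injEq, sr.injEq] at hq
        obtain ⟨rfl, h2⟩ := hq
        have : p.2 = q2 := Multiplicative.ofAdd.injective h2
        subst this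
        exact hq'
    · exact fun hp => ⟨p, Or.inr ⟨rfl, hp⟩⟩

/-- **The mirror type is a CM set for `c₀ = ρ(h)`**: `x ∈ T ↔ ρ(h) · x ∉ T`. [cite: Shimura1998, §18.2 Lemma (i)] -/
theorem mirror_mem_iff (hS : ∀ k, k ∈ S₁ ↔ h + k ∉ S₁)
    (hTr : ∀ p, (r p.1, Multiplicative.ofAdd p.2) ∈ T ↔ p ∈ S₁)
    (hTs : ∀ p, (sr p.1, Multiplicative.ofAdd p.2) ∈ T ↔ t - p ∈ S₁)
    (x : DihedralGroup m × Multiplicative (ZMod 2)) :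
    x ∈ T ↔ ((r h.1, Multiplicative.ofAdd h.2) : DihedralGroup m × Multiplicative (ZMod 2)) * x ∉ T := by
  obtain ⟨p, rfl | rfl⟩ := exists_sheet x
  · rw [rot_mul_rot, hTr, hTr]
    exact hS p
  · rw [rot_mul_refl, hTs, hTs, show t - (p - h) = h + (t - p) by abel]
    exact hS (t - p)

/-- **The companion set is moved by `c₀`.** [folklore] -/
theorem comirror_moved (hS : ∀ k, k ∈ S₁ ↔ h + k ∉ S₁)
    (hDr : ∀ p, (r p.1, Multiplicative.ofAdd p.2) ∈ D ↔ p ∈ S₁) :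
    ∃ x ∈ D, ((r h.1, Multiplicative.ofAdd h.2) : DihedralGroup m × Multiplicative (ZMod 2)) * x ∉ D := by
  have hne : S₁.Nonempty := by
    by_contra h0
    rw [Finset.not_nonempty_iff_eq_empty] at h0
    have := (hS 0).2 (by rw [h0]; exact Finset.notMem_empty _)
    rw [h0] at this
    exact Finset.notMem_empty _ this
  obtain ⟨k₀, hk₀⟩ := hne
  exact ⟨_, (hDr k₀).2 hk₀, by rw [rot_mul_rot, hDr]; exact (hS k₀).1 hk₀⟩

/-- **THE BALANCED SET**: `2 · #{x ∈ D : x g ∈ T} = #D` for every `g`, by the symmetry of the autocorrelation of `S₁`.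
[cite: Gordon1999HodgeAVSurvey, §9.3] -/
theorem mirror_balanced [NeZero m] (hS : ∀ k, k ∈ S₁ ↔ h + k ∉ S₁)
    (hTr : ∀ p, (r p.1, Multiplicative.ofAdd p.2) ∈ T ↔ p ∈ S₁)
    (hTs : ∀ p, (sr p.1, Multiplicative.ofAdd p.2) ∈ T ↔ t - p ∈ S₁)
    (hDr : ∀ p, (r p.1, Multiplicative.ofAdd p.2) ∈ D ↔ p ∈ S₁)
    (hDs : ∀ p, (sr p.1, Multiplicative.ofAdd p.2) ∈ D ↔ t - p ∉ S₁)
    (g : DihedralGroup m × Multiplicative (ZMod 2)) : 2 * (D.filter fun x => x * g ∈ T).card = D.card := by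
  classical
  have hcard := two_mul_card_of_half S₁ h hS
  have hA : Fintype.card (ZMod m × ZMod 2) = 2 * m := by
    rw [Fintype.card_prod, ZMod.card, ZMod.card]; ring
  -- `#D = 2m`
  have hD : D.card = 2 * m := by
    have h1 : D = Finset.univ.filter fun x => x ∈ D := by simp
    rw [h1, card_filter_sheets]
    simp only [hDr, hDs, Finset.filter_univ_mem]
    rw [card_filter_sub_left (fun u => u ∉ S₁) t]
    have h2 : (Finset.univ.filter fun u : ZMod m × ZMod 2 => u ∉ S₁) = S₁ᶜ := by ext; simp
    rw [h2, Finset.card_compl, hA]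
    have h3 : S₁.card ≤ Fintype.card (ZMod m × ZMod 2) := Finset.card_le_univ S₁
    omega
  have hfilter : (D.filter fun x => x * g ∈ T) = Finset.univ.filter fun x => x ∈ D ∧ x * g ∈ T := by
    ext x; simp
  rw [hD, hfilter, card_filter_sheets]
  obtain ⟨j, rfl | rfl⟩ := exists_sheet g
  · -- `g = ρ j`
    simp only [rot_mul_rot, refl_mul_rot, hDr, hDs, hTr, hTs]
    have h2 : (Finset.univ.filter fun k : ZMod m × ZMod 2 => t - k ∉ S₁ ∧ t - (k + j) ∈ S₁).card =
        (Finset.univ.filter fun u : ZMod m × ZMod 2 => u ∉ S₁ ∧ u + -j ∈ S₁).card := by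
      rw [← card_filter_sub_left (fun u => u ∉ S₁ ∧ u + -j ∈ S₁) t]
      congr 1
      refine Finset.filter_congr fun k _ => ?_
      rw [show t - (k + j) = t - k + -j by abel]
    have h3 := card_filter_not_mem_add S₁ (-j)
    have h4 := card_autocorrelation_symm S₁ j
    simp only [← sub_eq_add_neg] at h3 h4 h2
    omega
  · -- `g = σ j`
    simp only [rot_mul_refl, refl_mul_refl, hDr, hDs, hTr, hTs]
    have h1 : (Finset.univ.filter fun k : ZMod m × ZMod 2 => k ∈ S₁ ∧ t - (j - k) ∈ S₁).card =
        (Finset.univ.filter fun k : ZMod m × ZMod 2 => k ∈ S₁ ∧ k + (t - j) ∈ S₁).card := by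
      congr 1
      refine Finset.filter_congr fun k _ => ?_
      rw [show t - (j - k) = k + (t - j) by abel]
    have h2 : (Finset.univ.filter fun k : ZMod m × ZMod 2 => t - k ∉ S₁ ∧ j - k ∈ S₁).card =
        (Finset.univ.filter fun u : ZMod m × ZMod 2 => u ∉ S₁ ∧ u + (j - t) ∈ S₁).card := by
      rw [← card_filter_sub_left (fun u => u ∉ S₁ ∧ u + (j - t) ∈ S₁) t]
      congr 1
      refine Finset.filter_congr fun k _ => ?_
      rw [show t - k + (j - t) = j - k by abel]
    have h3 := card_filter_not_mem_add S₁ (j - t)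
    have h4 := card_autocorrelation_symm S₁ (j - t)
    have h5 : (Finset.univ.filter fun k : ZMod m × ZMod 2 => k ∈ S₁ ∧ k - (j - t) ∈ S₁).card =
        (Finset.univ.filter fun k : ZMod m × ZMod 2 => k ∈ S₁ ∧ k + (t - j) ∈ S₁).card := by
      congr 1
      refine Finset.filter_congr fun k _ => ?_
      rw [show k - (j - t) = k + (t - j) by abel]
    omega

/-- **Trivial left stabiliser** of the mirror type when `S₁` is aperiodic and asymmetric in `A = ℤ/m × ℤ/2`.
[cite: Shimura1998, §8.2 Prop. 26] -/
theorem mirror_leftStabiliser (haper : ∀ j : ZMod m × ZMod 2, j ≠ 0 → ∃ k, ¬ (k ∈ S₁ ↔ j + k ∈ S₁))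
    (hasym : ∀ u : ZMod m × ZMod 2, ∃ k, ¬ (k ∈ S₁ ↔ u - k ∈ S₁))
    (hTr : ∀ p, (r p.1, Multiplicative.ofAdd p.2) ∈ T ↔ p ∈ S₁)
    (hTs : ∀ p, (sr p.1, Multiplicative.ofAdd p.2) ∈ T ↔ t - p ∈ S₁)
    (v : DihedralGroup m × Multiplicative (ZMod 2)) (hv : v ≠ 1) :
    ∃ w : DihedralGroup m × Multiplicative (ZMod 2), ¬ (w ∈ T ↔ v * w ∈ T) := by
  obtain ⟨j, rfl | rfl⟩ := exists_sheet v
  · have hj : j ≠ 0 := by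
      rintro rfl
      exact hv (Prod.ext (by simp) (by simp))
    obtain ⟨k, hk⟩ := haper j hj
    exact ⟨(r k.1, Multiplicative.ofAdd k.2), by rwa [rot_mul_rot, hTr, hTr]⟩
  · obtain ⟨k, hk⟩ := hasym (t - j)
    exact ⟨(r k.1, Multiplicative.ofAdd k.2), by rwa [refl_mul_rot, hTr, hTs, show t - (j + k) = t - j - k by abel]⟩

end Mirror

/-! ## §4 Field level -/

section Field

variable {K : Type} [Field K] [NumberField K] [IsCMField K] [IsGalois ℚ K]
variable {m : ℕ} [NeZero m]

/-- **Mirror types are PRIMITIVE and DEGENERATE** (`G₀ = D_m × C₂`, `e(c) = ρ(h)`, `S₁` an aperiodic asymmetric CM half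
of `ℤ/m × ℤ/2` for `h`). [cite: Shimura1998, §8.2 Prop. 26] [cite: Gordon1999HodgeAVSurvey, §9.3] [cite: Kubota1965, §2] -/
theorem exists_isPrimitive_not_isNondegenerate_of_mirror₂
    (e : (K ≃ₐ[ℚ] K) ≃* DihedralGroup m × Multiplicative (ZMod 2)) (h : ZMod m × ZMod 2)
    (hc : e ((IsCMField.complexConj K).restrictScalars ℚ) = (r h.1, Multiplicative.ofAdd h.2))
    (S₁ : Finset (ZMod m × ZMod 2)) (t : ZMod m × ZMod 2) (hS : ∀ k, k ∈ S₁ ↔ h + k ∉ S₁)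
    (haper : ∀ j : ZMod m × ZMod 2, j ≠ 0 → ∃ k, ¬ (k ∈ S₁ ↔ j + k ∈ S₁))
    (hasym : ∀ u : ZMod m × ZMod 2, ∃ k, ¬ (k ∈ S₁ ↔ u - k ∈ S₁)) (φ₀ : K →+* ℂ) :
    ∃ Φ : CMType K, IsPrimitive (ℂ ≃+* ℂ) Φ.1 φ₀ ∧ ¬ IsNondegenerate Φ := by
  classical
  obtain ⟨T, hTr, hTs⟩ := exists_mirror S₁ t
  obtain ⟨D, hDr, hDs⟩ := exists_comirror S₁ t
  exact exists_isPrimitive_not_isNondegenerate_of_model_balanced e _ hc T (mirror_mem_iff hS hTr hTs)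
    (mirror_leftStabiliser haper hasym hTr hTs) D (mirror_balanced hS hTr hTs hDr hDs) (comirror_moved hS hDr) φ₀

/-- **… realised: a SIMPLE DEGENERATE abelian variety of dimension `2m` with CM by `K`**, with an exceptional Hodge
class on some power. [cite: Shimura1998, §6.2 Thm. 3 and §8.2 Prop. 26] [cite: Gordon1999HodgeAVSurvey, Thm. 6.4] -/
theorem exists_simple_degenerate_of_mirror₂
    (e : (K ≃ₐ[ℚ] K) ≃* DihedralGroup m × Multiplicative (ZMod 2)) (h : ZMod m × ZMod 2)
    (hc : e ((IsCMField.complexConj K).restrictScalars ℚ) = (r h.1, Multiplicative.ofAdd h.2))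
    (S₁ : Finset (ZMod m × ZMod 2)) (t : ZMod m × ZMod 2) (hS : ∀ k, k ∈ S₁ ↔ h + k ∉ S₁)
    (haper : ∀ j : ZMod m × ZMod 2, j ≠ 0 → ∃ k, ¬ (k ∈ S₁ ↔ j + k ∈ S₁))
    (hasym : ∀ u : ZMod m × ZMod 2, ∃ k, ¬ (k ∈ S₁ ↔ u - k ∈ S₁)) :
    ∃ (Φ : CMType K) (φ₀ : K →+* ℂ) (A : AbelianVariety ℂ) (ι : 𝓞 K →+* End A)
      (θ : K →+* Module.End ℂ (complexBetti A.X 1)),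
      IsPrimitive (ℂ ≃+* ℂ) Φ.1 φ₀ ∧ ¬ IsNondegenerate Φ ∧ IsCMTypeRealisation Φ A ι θ ∧ A.IsSimple ∧
      A.dim = 2 * m ∧
      ∃ n p : ℕ, ∃ x : complexBetti (⨁ fun _ : Fin n => A).X (2 * p), IsRationalClass x ∧
        IsOfHodgeType (⨁ fun _ : Fin n => A).dim (⨁ fun _ : Fin n => A).X (2 * p) p p x ∧
        x ∉ divisorClassesSpan (⨁ fun _ : Fin n => A).X (⨁ fun _ : Fin n => A).dim p := by
  classical
  obtain ⟨T, hTr, hTs⟩ := exists_mirror S₁ t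
  obtain ⟨D, hDr, hDs⟩ := exists_comirror S₁ t
  have hmain := exists_simple_degenerate_of_model_balanced e _ hc T (mirror_mem_iff hS hTr hTs)
    (mirror_leftStabiliser haper hasym hTr hTs) D (mirror_balanced hS hTr hTs hDr hDs) (comirror_moved hS hDr)
  have hdim : Fintype.card (DihedralGroup m × Multiplicative (ZMod 2)) / 2 = 2 * m := by
    rw [Fintype.card_prod, DihedralGroup.card, Fintype.card_multiplicative, ZMod.card]; omega
  rwa [hdim] at hmain

end Field

end Summit.HodgeConjecture.CorCM.GaloisDihedralTimesTwo

end
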